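import Summits.Ventures.PercRepro.RankLevelSetHallTiltS

/-!
# PercRepro — THE WITHIN-`S` TILT IS `Z`-LOCAL: THE DENOMINATOR IDENTITY AND THE LOST-PAIR DICHOTOMY
(p4, gen 39; paper proofs/P4-TILT-S.md §2; C-044, UP form, tight layer `#E = p + q`, any `k`)

For a member `Z` with flat `F = cl Z` and a `Y`-set `S ⊇ Z`, the denominator of the within-`S` tilt R11 is
`Σ_{T ⊆ S} θ_S(T) = m(S) + (τ/q)·Σ_{T ⊆ S} d_S(T)` (`tiltS_denom_eq`), and `Σ_T d_S(T)` counts the LOST PAIRS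
`(T, z)`: `T` a member inside `S`, `z ∈ (cl T ∩ S) ∖ T` — equivalently the pairs `(T, W)` with `W = T ∪ {z} ⊆ S` a
`(q+1)`-set of rank `q` (`eRk_insert_of_mem_closure_eq_eRk`).  THIS FILE proves the two facts that make the count visible
from `Z`'s own data: (i) a member `T ⊆ F` has `cl T = F` (`closure_eq_of_subset_closure_of_mem_cellMembers`), so its
deficit inside `S` is exactly `#(F ∩ S) − q` (`tiltSDef_add_q_of_subset_closure`) — `Z`'s flat-mates all carry `Z`'s own
tilt; (ii) **THE LOST-PAIR DICHOTOMY** (`lost_pair_dichotomy`): for EVERY member `T` and `z ∈ cl T ∖ T`, the rank-`q`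
set `W = T ∪ {z}` satisfies `r(W ∩ F) + r(F ∪ W) ≤ 2q` (submodularity), hence EITHER `W ∩ F` is dependent in `M|F`
(type β) OR `W ∖ F` is dependent over `F`, i.e. `r(F ∪ W) < q + #(W ∖ F)` (type α).  So the competitors' tilts are
counted from the dependent sets of `M|F` and of `M/F` alone; on `M₀ = U_{q,q+d} ⊕ Free` both are empty and the
competitors have tilt `0` (the exact type-level receipts of the paper).  Nothing is asserted about the receipts.

* `closure_eq_of_subset_closure_of_mem_cellMembers`, `tiltSDef_add_q_of_subset_closure`;
* `tiltS_denom_eq`, `eRk_insert_of_mem_closure_eq_eRk`, **`lost_pair_dichotomy`**, `tiltS_lost_sum_split`.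
Axioms: standard.
-/

namespace PercRepro

open Set Matroid Finset

variable {α : Type} (M : Matroid α) [M.Finite]

/-- A member `T` inside the closure flat of a member `Z` has the same closure: `cl T = cl Z` (both have rank `q`). -/
theorem closure_eq_of_subset_closure_of_mem_cellMembers (p q : ℕ) {Z T : Set α} (hZ : Z ∈ cellMembers M p q)
    (hT : T ∈ cellMembers M p q) (hTF : T ⊆ M.closure Z) : M.closure T = M.closure Z := by
  have hTfin : T.Finite := M.set_finite T hT.1
  have hrk : M.eRk (M.closure Z) ≤ M.eRk T := by
    rw [M.eRk_closure_eq, hZ.2.1, hT.2.1]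
  have h := (M.isRkFinite_of_finite hTfin).closure_eq_closure_of_subset_of_eRk_ge_eRk hTF hrk
  rw [h, M.closure_closure]

/-- The deficit inside `S` of a flat-mate `T ⊆ cl Z` of `Z` (both members inside `S`, tight layer):
`d_S(T) + q = #(cl Z ∩ S)`. -/
theorem tiltSDef_add_q_of_subset_closure (p q : ℕ) (hE : M.E.ncard = p + q) {Z T S : Set α}
    (hZ : Z ∈ cellMembers M p q) (hT : T ∈ cellMembers M p q) (hTF : T ⊆ M.closure Z) (hTS : T ⊆ S) :
    tiltSDef M S T + q = (M.closure Z ∩ S).ncard := by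
  unfold tiltSDef
  rw [closure_eq_of_subset_closure_of_mem_cellMembers M p q hZ hT hTF]
  have hfin : (M.closure Z ∩ S).Finite := M.set_finite _ (inter_subset_left.trans (M.closure_subset_ground Z))
  have hsub : T ⊆ M.closure Z ∩ S := subset_inter hTF hTS
  have h := ncard_sdiff_add_ncard_of_subset hsub hfin
  rw [ncard_eq_q_of_mem_cellMembers_tight M hE hT] at h
  exact h

omit [M.Finite] in
/-- **The denominator identity**: `Σ_{T ∈ 𝒯} θ_S(T) = #𝒯 + (τ/q)·Σ_{T ∈ 𝒯} d_S(T)` for any finset `𝒯` of sets. -/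
theorem tiltS_denom_eq (q : ℕ) (τ : ℚ) (S : Set α) (𝒯 : Finset (Set α)) :
    ∑ T ∈ 𝒯, tiltSTheta M q τ S T = (𝒯.card : ℚ) + τ / (q : ℚ) * ∑ T ∈ 𝒯, ((tiltSDef M S T : ℕ) : ℚ) := by
  unfold tiltSTheta
  rw [Finset.sum_add_distrib, Finset.sum_const, nsmul_eq_mul, mul_one, Finset.mul_sum]
  congr 1
  apply Finset.sum_congr rfl
  intro T _
  ring

omit [M.Finite] in
/-- Adding an element of the closure does not change the rank: `z ∈ cl T ⟹ r(T ∪ {z}) = r(T)`. -/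
theorem eRk_insert_of_mem_closure_eq_eRk {T : Set α} {z : α} (hz : z ∈ M.closure T) :
    M.eRk (insert z T) = M.eRk T := by
  rw [← M.eRk_closure_eq (insert z T), closure_insert_eq_of_mem_closure hz, M.eRk_closure_eq]

/-- **THE LOST-PAIR DICHOTOMY** (tight layer): for members `Z`, `T` and `z ∈ cl T ∖ T`, with `F = cl Z` and
`W = T ∪ {z}` (a `(q+1)`-set of rank `q`): EITHER `W ∩ F` is dependent (type β: a dependent set of `M|F`),
OR `r(F ∪ W) < q + #(W ∖ F)`, i.e. `W ∖ F` is dependent over `F` (type α: a dependent set of `M/F`).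
Proof: `r(W ∩ F) + r(F ∪ W) ≤ r(F) + r(W) = 2q` by submodularity; if `W ∩ F` is independent then
`r(W ∩ F) = #(W ∩ F) = q + 1 − #(W ∖ F)`, and `r(F ∪ W) ≥ q + #(W ∖ F)` would give `2q + 1 ≤ 2q`. -/
theorem lost_pair_dichotomy (p q : ℕ) (hE : M.E.ncard = p + q) {Z T : Set α} (hZ : Z ∈ cellMembers M p q)
    (hT : T ∈ cellMembers M p q) {z : α} (hz : z ∈ M.closure T) (hzT : z ∉ T) :
    M.eRk (insert z T ∩ M.closure Z) < (insert z T ∩ M.closure Z).encard ∨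
      M.eRk (M.closure Z ∪ insert z T) < (q : ℕ∞) + (insert z T \ M.closure Z).encard := by
  set F : Set α := M.closure Z with hF
  set W : Set α := insert z T with hW
  have hWrk : M.eRk W = (q : ℕ∞) := by
    rw [hW, eRk_insert_of_mem_closure_eq_eRk M hz, hT.2.1]
  have hFrk : M.eRk F = (q : ℕ∞) := by
    rw [hF, M.eRk_closure_eq, hZ.2.1]
  have hsub : M.eRk (F ∩ W) + M.eRk (F ∪ W) ≤ (q : ℕ∞) + (q : ℕ∞) := by
    have h := M.eRk_inter_add_eRk_union_le F W
    rwa [hFrk, hWrk] at h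
  have hTfin : T.Finite := M.set_finite T hT.1
  have hTcard : T.encard = (q : ℕ∞) := by
    rw [← hTfin.cast_ncard_eq, ncard_eq_q_of_mem_cellMembers_tight M hE hT]
  have hWcard : W.encard = (q : ℕ∞) + 1 := by
    rw [hW, Set.encard_insert_of_notMem hzT, hTcard]
  have hsplit : (W \ F).encard + (W ∩ F).encard = W.encard := Set.encard_sdiff_add_encard_inter W F
  by_contra hcon
  have h1 : (W ∩ F).encard ≤ M.eRk (W ∩ F) := not_lt.mp (fun h => hcon (Or.inl h))
  have h2 : (q : ℕ∞) + (W \ F).encard ≤ M.eRk (F ∪ W) := not_lt.mp (fun h => hcon (Or.inr h))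
  -- `W ∩ F` independent: its rank is its size
  have hrkWF : M.eRk (W ∩ F) = (W ∩ F).encard := le_antisymm (M.eRk_le_encard _) h1
  have hFW : F ∩ W = W ∩ F := Set.inter_comm F W
  rw [hFW, hrkWF] at hsub
  -- chain: (W ∩ F).encard + (q + (W \ F).encard) ≤ (W ∩ F).encard + r(F ∪ W) ≤ q + q
  have hchain : (W ∩ F).encard + ((q : ℕ∞) + (W \ F).encard) ≤ (q : ℕ∞) + (q : ℕ∞) :=
    le_trans (add_le_add (le_refl ((W ∩ F).encard)) h2) hsub
  have hleft : (W ∩ F).encard + ((q : ℕ∞) + (W \ F).encard) = (q : ℕ∞) + 1 + (q : ℕ∞) := by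
    calc (W ∩ F).encard + ((q : ℕ∞) + (W \ F).encard)
        = ((W \ F).encard + (W ∩ F).encard) + (q : ℕ∞) := by ring
      _ = (q : ℕ∞) + 1 + (q : ℕ∞) := by rw [hsplit, hWcard]
  rw [hleft] at hchain
  have hnat : ((q + 1 + q : ℕ) : ℕ∞) ≤ ((q + q : ℕ) : ℕ∞) := by
    push_cast
    exact hchain
  have := ENat.coe_le_coe.mp hnat
  omega

open Classical in
/-- **The split of the lost-pair sum** (tight layer): for a member `Z` inside the `Y`-set `S`, with `F = cl Z` and
`R = F ∩ S`, the flat-mates `T ⊆ F` of `Z` each contribute exactly `#R − q` to `Σ_T d_S(T)`, so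
`Σ_{T ∈ 𝒯} d_S(T) = b(R)·(#R − q) + Σ_{T ∈ 𝒯, T ⊄ F} d_S(T)` (`𝒯` = the members inside `S`); the second sum is
the competitors' part, each of whose pairs obeys `lost_pair_dichotomy`. -/
theorem tiltS_lost_sum_split (p q : ℕ) (hE : M.E.ncard = p + q) {Z S : Set α} (hZ : Z ∈ cellMembers M p q) :
    ∑ T ∈ (eqMembers_finite M p q S).toFinset, tiltSDef M S T =
      ((eqMembers_finite M p q S).toFinset.filter (fun T => T ⊆ M.closure Z)).card *
          ((M.closure Z ∩ S).ncard - q) +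
        ∑ T ∈ (eqMembers_finite M p q S).toFinset.filter (fun T => ¬ T ⊆ M.closure Z), tiltSDef M S T := by
  set Ef : Finset (Set α) := (eqMembers_finite M p q S).toFinset with hEf
  have hmemE : ∀ T, T ∈ Ef ↔ T ∈ cellMembers M p q ∧ T ⊆ S := fun T => by
    rw [hEf, (eqMembers_finite M p q S).mem_toFinset]
    rfl
  rw [← Finset.sum_filter_add_sum_filter_not Ef (fun T => T ⊆ M.closure Z)]
  congr 1
  rw [Finset.card_eq_sum_ones, Finset.sum_mul, one_mul]
  apply Finset.sum_congr rfl
  intro T hT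
  rw [Finset.mem_filter, hmemE] at hT
  have h := tiltSDef_add_q_of_subset_closure M p q hE hZ hT.1.1 hT.2 hT.1.2
  omega

end PercRepro
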